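import Mathlib
import Summits.MatrixMultiplication.MatrixMultiplication.Theorems.SnSubsetDichotomyPolynomialSlackBallCertificate

/-!
# Energy floor for the centred level-one triple sum

Crux `Summit.MatrixMultiplication.MatrixMultiplication.Theses.SnSubsetDichotomy.PolynomialSlack`
(item `stmt-MatrixMultiplication-8306`), level-one programme, lead c5 (wave 3). Everything at level one
is a function of the three doubly stochastic set profiles `d_S, d_T, d_U` (rows = values, columns =
positions): the pair profiles are `d_Sᵀ d_T` etc. (tree: `pairMarginal_eq_sum_mul`), their centrings are
the products of the centred set profiles (`sum_mul_sub_inv_eq_sum_centered`), and the centred level-one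
triple sum is `τ = Tr(E_S E_T E_U)` with `E_X = Δ_X Δ_Xᵀ`. Writing `E_U = Σ_k u_k u_kᵀ` over the COLUMNS
`u_k` of `Δ_U` (no spectral theorem needed) and applying the Gram bound `uᵀE_SE_Tu ≥ −‖u‖²/8`
(`gram_quadForm_ge`, from the ball certificate) column by column gives

* `neg_centeredTripleSum_le_energy` — `−τ ≤ ‖Δ_U‖_F²/8`, `‖Δ_U‖_F² = Σ_{v,k} (d_U(v,k) − 1/n)²`.

By the symmetry of `τ` the same holds with `S` or `T` in place of `U`. Played against the pinning this is
the COLLISION FLOOR of the next file: every member of a near-extremal TPP triple has level-one energy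
`≥ 8/n`.
-/

namespace Summit.MatrixMultiplication.MatrixMultiplication.Theorems.PolynomialSlack

open scoped BigOperators

set_option linter.dupNamespace false

/-- Centring of a pair profile: for arrays with unit column sums,
`Σ_v dX(v,j)·dY(v,k) − 1/n = Σ_v (dX(v,j) − 1/n)(dY(v,k) − 1/n)` (`n ≠ 0`). [folklore] -/
theorem sum_mul_sub_inv_eq_sum_centered {n : ℕ} (hn : n ≠ 0) (dX dY : Fin n → Fin n → ℝ)
    (hXcol : ∀ i, ∑ v, dX v i = 1) (hYcol : ∀ i, ∑ v, dY v i = 1) (j k : Fin n) :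
    (∑ v, dX v j * dY v k) - 1 / n = ∑ v, (dX v j - 1 / n) * (dY v k - 1 / n) := by
  have hnR : (n : ℝ) ≠ 0 := by exact_mod_cast hn
  have e : ∀ v, (dX v j - 1 / n) * (dY v k - 1 / n) =
      dX v j * dY v k - (1 / n) * dY v k - (1 / n) * dX v j + 1 / n * (1 / n) := fun v => by ring
  simp_rw [e]
  rw [Finset.sum_add_distrib, Finset.sum_sub_distrib, Finset.sum_sub_distrib, ← Finset.mul_sum,
    ← Finset.mul_sum, hXcol j, hYcol k, Finset.sum_const, Finset.card_univ, Fintype.card_fin]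
  simp only [nsmul_eq_mul]
  field_simp
  ring

/-- **Energy floor for the centred level-one triple sum.** For three doubly stochastic arrays
`dS, dT, dU` (the value/position profiles of three sets of permutations) the centred triple sum
`τ = Σ_{i,j,k} (Σ_v dS dT − 1/n)(Σ_v dT dU − 1/n)(Σ_v dU dS − 1/n)` satisfies `−τ ≤ ‖Δ_U‖²/8`,
`‖Δ_U‖² = Σ_{v,k} (dU(v,k) − 1/n)²`: `τ = Σ_k u_kᵀ E_S E_T u_k` over the columns `u_k` of `Δ_U`, and each
term is `≥ −‖u_k‖²/8` (`gram_quadForm_ge`). [folklore] -/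
theorem neg_centeredTripleSum_le_energy {n : ℕ} (hn : n ≠ 0) (dS dT dU : Fin n → Fin n → ℝ)
    (hS0 : ∀ v i, 0 ≤ dS v i) (hSrow : ∀ v, ∑ i, dS v i = 1) (hScol : ∀ i, ∑ v, dS v i = 1)
    (hT0 : ∀ v i, 0 ≤ dT v i) (hTrow : ∀ v, ∑ i, dT v i = 1) (hTcol : ∀ i, ∑ v, dT v i = 1)
    (hUcol : ∀ i, ∑ v, dU v i = 1) :
    -(∑ i, ∑ j, ∑ k, ((∑ v, dS v i * dT v j) - 1 / n) * ((∑ v, dT v j * dU v k) - 1 / n) *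
        ((∑ v, dU v k * dS v i) - 1 / n)) ≤ (∑ v, ∑ k, (dU v k - 1 / n) ^ 2) / 8 := by
  -- centred arrays
  set ΔS : Fin n → Fin n → ℝ := fun v i => dS v i - 1 / n with hΔS
  set ΔT : Fin n → Fin n → ℝ := fun v i => dT v i - 1 / n with hΔT
  set ΔU : Fin n → Fin n → ℝ := fun v i => dU v i - 1 / n with hΔU
  -- (1) centring of the three pair profiles
  have cA : ∀ i j, (∑ v, dS v i * dT v j) - 1 / n = ∑ w, ΔS w i * ΔT w j := fun i j =>
    sum_mul_sub_inv_eq_sum_centered hn dS dT hScol hTcol i j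
  have cB : ∀ j k, (∑ v, dT v j * dU v k) - 1 / n = ∑ v, ΔT v j * ΔU v k := fun j k =>
    sum_mul_sub_inv_eq_sum_centered hn dT dU hTcol hUcol j k
  have cC : ∀ k i, (∑ v, dU v k * dS v i) - 1 / n = ∑ v, ΔS v i * ΔU v k := fun k i => by
    rw [sum_mul_sub_inv_eq_sum_centered hn dU dS hUcol hScol k i]
    exact Finset.sum_congr rfl fun v _ => mul_comm _ _
  simp_rw [cA, cB, cC]
  -- names: A i j, sv k i = Σ_v ΔS v i ΔU v k, tv k j = Σ_v ΔT v j ΔU v k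
  set A : Fin n → Fin n → ℝ := fun i j => ∑ w, ΔS w i * ΔT w j with hA
  set sv : Fin n → Fin n → ℝ := fun k i => ∑ v, ΔS v i * ΔU v k with hsv
  set tv : Fin n → Fin n → ℝ := fun k j => ∑ v, ΔT v j * ΔU v k with htv
  change -(∑ i, ∑ j, ∑ k, A i j * tv k j * sv k i) ≤ (∑ v, ∑ k, ΔU v k ^ 2) / 8
  -- (2) reorder: Σ_i Σ_j Σ_k → Σ_k Σ_i Σ_j
  have hre : ∑ i, ∑ j, ∑ k, A i j * tv k j * sv k i = ∑ k, ∑ i, ∑ j, A i j * sv k i * tv k j := by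
    have h1 : ∀ i, ∑ j, ∑ k, A i j * tv k j * sv k i = ∑ k, ∑ j, A i j * sv k i * tv k j := by
      intro i
      rw [Finset.sum_comm]
      exact Finset.sum_congr rfl fun k _ => Finset.sum_congr rfl fun j _ => by ring
    simp_rw [h1]
    rw [Finset.sum_comm]
  rw [hre]
  -- (3) each k-slice is the Gram quadratic form of L3 with u = ΔU · k
  have hslice : ∀ k, ∑ w, (∑ i, ΔS w i * sv k i) * (∑ j, ΔT w j * tv k j) =
      ∑ i, ∑ j, A i j * sv k i * tv k j := by
    intro k
    have e : ∀ w, (∑ i, ΔS w i * sv k i) * (∑ j, ΔT w j * tv k j) =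
        ∑ i, ∑ j, ΔS w i * sv k i * (ΔT w j * tv k j) := fun w => by
      rw [Finset.sum_mul_sum]
    simp_rw [e]
    rw [Finset.sum_comm]
    refine Finset.sum_congr rfl fun i _ => ?_
    rw [Finset.sum_comm]
    refine Finset.sum_congr rfl fun j _ => ?_
    have hAij : A i j = ∑ w, ΔS w i * ΔT w j := rfl
    rw [hAij, Finset.sum_mul, Finset.sum_mul]
    exact Finset.sum_congr rfl fun w _ => by ring
  simp_rw [← hslice]
  -- (4) apply the Gram bound slice by slice and sum
  have hk : ∀ k, -(∑ w, (∑ i, ΔS w i * sv k i) * (∑ j, ΔT w j * tv k j)) ≤ (∑ v, ΔU v k ^ 2) / 8 := by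
    intro k
    have h := gram_quadForm_ge dS dT hS0 hSrow hScol hT0 hTrow hTcol (fun v => ΔU v k)
    -- unfold the slice into L3's literal form
    have esv : ∀ i, sv k i = ∑ v', (dS v' i - 1 / n) * ΔU v' k := fun i => rfl
    have etv : ∀ j, tv k j = ∑ v, (dT v j - 1 / n) * ΔU v k := fun j => rfl
    simp_rw [esv, etv]
    exact h
  rw [← Finset.sum_neg_distrib]
  calc ∑ k, -(∑ w, (∑ i, ΔS w i * sv k i) * (∑ j, ΔT w j * tv k j))
      ≤ ∑ k, (∑ v, ΔU v k ^ 2) / 8 := Finset.sum_le_sum fun k _ => hk k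
    _ = (∑ v, ∑ k, ΔU v k ^ 2) / 8 := by rw [← Finset.sum_div, Finset.sum_comm]

end Summit.MatrixMultiplication.MatrixMultiplication.Theorems.PolynomialSlack
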